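import Summits.QuantumFields.YangMills.Theorems.FluctuationComparisonRegPrIntLS2BetaLiftLadderFaceRow
import Summits.QuantumFields.YangMills.Theorems.FluctuationComparisonRegPrIntLS2BetaLiftLadderCombRowTower
import HarnessLib

/-!
# S2β · THE SUP CHAIN, (LIFT-LAD′) ONE-PROFILE — THE LIFT ROW AT THE TOWER WITH THE LETTER-FREE DISCREPANCY SOURCE:
# `E′(t+1) ≤ ((1+κ)·(11∕10·L⁻¹)²)·E′(t) + (1+κ⁻¹)·D′(t+1)`, `D′` = the truncated discrepancy energy `Σ_B ‖𝟙_{READ′_{t+1}(B) ∧ ¬comb}·logVec (R⁻¹η)‖²`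

Cell `ym3-torus` (YM ladder rung R3 = continuum `SU(2)` Yang–Mills on the three-torus at fixed lattice data — a RUNG: NOT d = 4, NOT infinite volume,
NOT a mass gap, NOT Clay).  Width seat «width 20» `ym3-torus-px20` (gen 24), FREE px helper on crux `stmt-QuantumFields-20520`
(`…Theses.UnitScaleTilt.FluctuationComparisonRegPrIntL`), LINE g18-1 S2β, the (ST) sup chain: (ST′)∕(ST″) ⟸ LIFT-LADDER⁗ = {(TOP-LAD′), rows, budgets} (px10 g25
✓p831454 `…NestedSplit` ∕ ✓p832110 `…NestedBkg` ∕ ✓p832552 `…NestedLiftNc` over px17 g22 ✓p830137).  ARCHITECT RULING px17 g22 19:37:59Z (1): «LIFT-LADDER is ONE-PROFILE: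
per `B`, every bond of `READ′_{t+1}(B)` — comb, face-crossing, intra-block nc alike — has main part the relative lift `R` (`|log R|² ≤ (c²∕L²)·`parent read max, `c = 11∕10`
under the arc profile) and discrepancy `ε = R⁻¹η` (`= 1` on comb bonds by (T4)); so `E′(t+1) ≤ A·E′(t) + c(t+1)`, `A = (1+κ)·(11∕10)²∕L²`, `κ = 1∕5`,
`c(t+1) = (1+κ⁻¹)·Σ_B max_{READ′_{t+1}(B)} |log ε|²`».  THIS FILE types exactly that row at the T³ family's descended pair (the tower), with the source written
LETTER-FREE as the truncated discrepancy energy `D′(t+1)` (INTENT px20 g24 19:46:15Z; c₃ assembler per RULINGS 19:24:49Z): ✓p831454's abstract `c(t+1)` is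
instantiated by `(1+κ⁻¹)·D′(t+1)`, and (SCT′-c) becomes the suppliers' budget «`Σ_t L^t·D′(t) ≤ C·purse (+ β·S′)`» — px5 g23's per-`B` row ✓∕⧗Q11f∕Q11g bound `D′` per `B`
by `(sF + ladder·ρ̃)²` (intra-block ✓`norm_logVec_disc_le_of_intraBlock_stage`, face discrepancy RULING (i), `ρ̃` = px12 g26 (d)), px16 g23∕px13 g27 sum it in c₁'s currency.
It is the one-profile twin of px12 g26's ✓p831621 `combRow'` (same plumbing BY NAME: ✓`descendTo_apply_eq_iter_of_eq`, ✓`treeComb_siteShift`, ✓`read'_nest_of_feeds`,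
✓p831146 `blockIter_succ_eq_siteShift`) around px20's ✓p832421 engine (`norm_logVec_rawChord_le_lift_add_disc`, `pi_norm_trunc_le_of_row_add`, `disc_eq_one_of_treeComb`).
`--kind proof --supports stmt-QuantumFields-20520 --as helper`, count-neutral, DEFINITION-FREE (0 `def`, 0 `instance`, 0 `notation`, 0 `sorry`, default heartbeats).

WHAT IS PROVED (sorry-free).
* §1 ★★★`sq_pi_norm_trunc_le_of_lift_add_discNorm` — ONE `Params`, levels `j`∕`j+1`, ANY bond predicates `pS`∕`pT` with the hat feeders of `pS`-bonds inside `pT`, the `AxStage`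
  clause texts of ✓p831211 §2 + (T4)×2, `2 ≤ L`, arcs of the two coarse stage fields `≤ σ ≤ 1∕4` on `pT`, `κ > 0`:
  `‖𝟙_{pS}·logVec η_raw⁽ʲ⁾‖² ≤ (1+κ)·((11∕10)·L⁻¹)²·‖𝟙_{pT}·logVec η_raw⁽ʲ⁺¹⁾‖² + (1+κ⁻¹)·‖𝟙_{pS ∧ ¬comb}·logVec (R⁻¹η)‖²` — NO source letter (the source is the truncated
  discrepancy field itself; comb bonds contribute `0` by ✓`disc_eq_one_of_treeComb`).
* §2 ★★★`liftRow'` — THE TOWER EDITION: under ✓p831621 `combRow'`'s hypotheses VERBATIM (`wt lift U₁ g g₀ hwt hlift hT3 hT4 hT3' hT4' hU₀ hL2 hσ4 hArc`) + `(hκ : 0 < κ)`: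
  for every `t s` with `s = K − (J+t+2)` and `t + 1 < K − J`, `E′(t+1) ≤ ((1+κ)·(11∕10·L⁻¹)²)·E′(t) + (1+κ⁻¹)·D′(t+1)`, `E′` = the READ′ summand of FILE 3′∕3″∕3⁗ VERBATIM
  (✓p831146∕✓p831454∕✓p832552), `D′(t+1) := Σ_B ‖(fun ℓ′ => if READ′_{t+1}(B)(ℓ′) ∧ ¬comb(ℓ′) then logVec (su2Quat (R⁻¹η at σ₂ℓ′, height s of F.P K)) else 0)‖²` with
  `R = lift_s U′_{s+1}·(lift_s U₁′_{s+1})⁻¹`, `η = U′_s·(U₁′_s)⁻¹` (stage fields `U′_i = g_i • Ū^iU′`, `U₁′_i = g₀_i • Ū^iU₁`, `U′ = expPoint ζ • U₀`), `σ₂ = bondShift` to height `s`.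
  Consumers: px10 g25's station (`hREC′`∕`hLIFT` with `A := (1+κ)(11∕10·L⁻¹)²`, `c(t+1) := (1+κ⁻¹)·D′(t+1)`; `κ = 1∕5` gives `A·L = 0.484 ≤ ½` at `L = 3`), px5 g23 ⧗Q11g (per-`B`
  bound of `D′`), px16 g23∕px13 g27 ((SCT′-c) budget of `Σ_t L^t D′`).

INHABITATION (★★OWNER RULING №100): LAW-FREE — group algebra, the hat lift's log-linearity, Pi-sup and torus bookkeeping; no fibre law, no score, no integrability.

HONEST SCOPE.  Plumbing over landed letters by name; the arc profile `σ ≤ 1∕4` and every analytic letter are HYPOTHESES; nothing of Bałaban's renormalisation-group analysis is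
asserted or proved ([Balaban1985RegularSpaces] (1.19) p.79, (1.29) p.81; [Balaban1985Averaging] Prop. 4 (128)–(135) pp.37–38; [Balaban1987RG1] (0.1)–(0.4), (0.11)
pp.251–253 are the printed conventions this row transcribes); (TOP-LAD′), the budgets (SCT′), (ST″)∕(ST′)∕(ST), LOC″∕LOC, GAP♯∘ (`stub_uniformFibreGapOrbit`, registry 3732b7df
UNTOUCHED), the five registered stubs (0∕5), S2β, 20520, 19936, 19200, `YM3TorusSU2` are NOT proved; no registered stub is closed; rung R3 — NOT d = 4, NOT infinite
volume, NOT a mass gap, NOT Clay; the Yang–Mills mass gap is NOT proved.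
-/

set_option autoImplicit false

namespace Summit.QuantumFields.YangMills.Theorems.FluctuationComparisonRegPrIntLS2BetaLiftLadderOneProfileTower

open Finset
open scoped Real
open Literature.MathematicalPhysics.QuantumLattice (su2Quat)
open Literature.MathematicalPhysics.QuantumFieldTheory.Balaban1983to89
open T4Continuum T3ContinuumYM3Torus T3TiltDescent T3LevelShift BlockAveraging
open B10Eq27TorusAxialLog (rel axialT)
open T4CubeChartGnomonic (SU2)
open T4HaarSU2ExpChart (expPoint)
open T4ExpWindowSmallField (logVec)
open Summit.QuantumFields.YangMills.Theorems.FluctuationComparisonRegPrIntLS2BetaLiftLadderFaceRow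
  (norm_logVec_rawChord_le_lift_add_disc pi_norm_trunc_le_of_row_add disc_eq_one_of_treeComb)
open Summit.QuantumFields.YangMills.Theorems.FluctuationComparisonRegPrIntLS2BetaLiftLadderCombRowTower
  (descendTo_apply_eq_iter_of_eq treeComb_siteShift read'_nest_of_feeds)
open Summit.QuantumFields.YangMills.Theorems.FluctuationComparisonRegPrIntLS2BetaWeightedTwoProfileTowerSum (sq_le_of_le_mul_add)
open Summit.QuantumFields.YangMills.Theorems.FluctuationComparisonRegPrIntLS2BetaSupTowerOfLiftLadderNested (blockIter_succ_eq_siteShift)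

/-! ## §1 One `Params`: the lift row with the discrepancy source read as a TRUNCATED SUP NORM (no source letter) -/

section OneParams

variable {P : Params}

/-- ★★★ **THE ONE-PROFILE LIFT ROW WITH THE LETTER-FREE SOURCE, ONE `Params`**: as ✓`…LiftLadderFaceRow.sq_pi_norm_trunc_le_of_lift_add_disc_offComb`, but the source is
the Pi-sup norm of the discrepancy field `logVec (R_b⁻¹·η_b)` truncated to the `pS`-bonds OFF the tree comb — no `hdisc` letter:
`‖𝟙_{pS}·logVec η⁽ʲ⁾‖² ≤ (1+κ)·((11∕10)·L⁻¹)²·‖𝟙_{pT}·logVec η⁽ʲ⁺¹⁾‖² + (1+κ⁻¹)·‖𝟙_{pS ∧ ¬comb}·logVec ε‖²`. [cite: Balaban1985RegularSpaces, (1.19) p.79, (1.29) p.81; Balaban1985Averaging, Prop. 4 (128)-(135) p.37-38] -/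
theorem sq_pi_norm_trunc_le_of_lift_add_discNorm (av : ∀ i, Averaging P i SU2) {j : ℕ} (hj : j + 1 ≤ P.m + P.K)
    (wt : (i : ℕ) → PBond P i → PBond P (i + 1) → ℝ) (lift : (i : ℕ) → GaugeField P (i + 1) SU2 → GaugeField P i SU2)
    (g g₀ : (i : ℕ) → Site P i → SU2) (U U₁ U₀ : GaugeField P 0 SU2)
    (hwt : ∀ b e, wt j b e = if e.dir = b.dir ∧ (b.src b.dir - emb e.src b.dir).val < P.L then
      ∏ ν ∈ Finset.univ.erase b.dir, max 0 (1 - ((rel (emb e.src) b.src ν).natAbs : ℝ) / P.L) else 0)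
    (hlift : ∀ (X : GaugeField P (j + 1) SU2) (b : PBond P j), lift j X b = expPoint (∑ e, wt j b e • ((P.L : ℝ)⁻¹ • logVec (su2Quat (X e)))))
    (hT3 : ∀ X : GaugeField P 0 SU2, Averaging.iter av j (GaugeField.gaugeAct (g 0) X) = GaugeField.gaugeAct (g j) (Averaging.iter av j X))
    (hT3s : ∀ X : GaugeField P 0 SU2, Averaging.iter av (j + 1) (GaugeField.gaugeAct (g 0) X) = GaugeField.gaugeAct (g (j + 1)) (Averaging.iter av (j + 1) X))
    (hT3' : ∀ X : GaugeField P 0 SU2, Averaging.iter av j (GaugeField.gaugeAct (g₀ 0) X) = GaugeField.gaugeAct (g₀ j) (Averaging.iter av j X))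
    (hT3s' : ∀ X : GaugeField P 0 SU2, Averaging.iter av (j + 1) (GaugeField.gaugeAct (g₀ 0) X) = GaugeField.gaugeAct (g₀ (j + 1)) (Averaging.iter av (j + 1) X))
    (hU₀ : U₀ = GaugeField.gaugeAct (fun x => (g 0 x)⁻¹ * g₀ 0 x) U₁)
    (hT4 : ∀ x, axialT (GaugeField.gaugeAct (g j) (Averaging.iter av j U)) (emb (blockOf x)) x =
      axialT (lift j (GaugeField.gaugeAct (g (j + 1)) (Averaging.iter av (j + 1) U))) (emb (blockOf x)) x)
    (hT4' : ∀ x, axialT (GaugeField.gaugeAct (g₀ j) (Averaging.iter av j U₁)) (emb (blockOf x)) x =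
      axialT (lift j (GaugeField.gaugeAct (g₀ (j + 1)) (Averaging.iter av (j + 1) U₁))) (emb (blockOf x)) x)
    (hL2 : 2 ≤ P.L) {σ : ℝ} (hσ4 : σ ≤ 1 / 4)
    (pS : PBond P j → Prop) [DecidablePred pS] (pT : PBond P (j + 1) → Prop) [DecidablePred pT]
    (hnest : ∀ b, pS b → ∀ e, wt j b e ≠ 0 → pT e)
    (hσ : ∀ e, pT e → ‖logVec (su2Quat (GaugeField.gaugeAct (g (j + 1)) (Averaging.iter av (j + 1) U) e))‖ ≤ σ)
    (hσ' : ∀ e, pT e → ‖logVec (su2Quat (GaugeField.gaugeAct (g₀ (j + 1)) (Averaging.iter av (j + 1) U₁) e))‖ ≤ σ)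
    {κ : ℝ} (hκ : 0 < κ) :
    ‖(fun b : PBond P j => if pS b then logVec (su2Quat (Averaging.iter av j U b * (Averaging.iter av j U₀ b)⁻¹)) else 0)‖ ^ 2 ≤
      (1 + κ) * (11 / 10 * (P.L : ℝ)⁻¹) ^ 2 *
        ‖(fun e : PBond P (j + 1) => if pT e then logVec (su2Quat (Averaging.iter av (j + 1) U e * (Averaging.iter av (j + 1) U₀ e)⁻¹)) else 0)‖ ^ 2 +
      (1 + κ⁻¹) * ‖(fun b : PBond P j => if pS b ∧ ¬ (blockOf (b.src.shift b.dir) = blockOf b.src ∧ ∀ ν, ν < b.dir → rel (emb (blockOf b.src)) b.src ν = 0) then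
        logVec (su2Quat ((lift j (GaugeField.gaugeAct (g (j + 1)) (Averaging.iter av (j + 1) U)) b *
            (lift j (GaugeField.gaugeAct (g₀ (j + 1)) (Averaging.iter av (j + 1) U₁)) b)⁻¹)⁻¹ *
          (GaugeField.gaugeAct (g j) (Averaging.iter av j U) b * (GaugeField.gaugeAct (g₀ j) (Averaging.iter av j U₁) b)⁻¹))) else 0)‖ ^ 2 := by
  -- Young's split, then the row with the pointwise source = the norm of the truncated discrepancy field at `b`
  refine sq_le_of_le_mul_add (norm_nonneg _) (by positivity) (norm_nonneg _) hκ ?_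
  have hc0 : (0 : ℝ) ≤ 11 / 10 * (P.L : ℝ)⁻¹ := by positivity
  refine pi_norm_trunc_le_of_row_add pS pT (fun b e => wt j b e ≠ 0)
    (fun b => logVec (su2Quat (Averaging.iter av j U b * (Averaging.iter av j U₀ b)⁻¹)))
    (fun e => logVec (su2Quat (Averaging.iter av (j + 1) U e * (Averaging.iter av (j + 1) U₀ e)⁻¹)))
    hc0
    (fun b => ‖(fun b : PBond P j => if pS b ∧ ¬ (blockOf (b.src.shift b.dir) = blockOf b.src ∧ ∀ ν, ν < b.dir → rel (emb (blockOf b.src)) b.src ν = 0) then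
        logVec (su2Quat ((lift j (GaugeField.gaugeAct (g (j + 1)) (Averaging.iter av (j + 1) U)) b *
            (lift j (GaugeField.gaugeAct (g₀ (j + 1)) (Averaging.iter av (j + 1) U₁)) b)⁻¹)⁻¹ *
          (GaugeField.gaugeAct (g j) (Averaging.iter av j U) b * (GaugeField.gaugeAct (g₀ j) (Averaging.iter av j U₁) b)⁻¹))) else 0) b‖)
    (norm_nonneg _) (fun b _ => norm_le_pi_norm
      (fun b : PBond P j => if pS b ∧ ¬ (blockOf (b.src.shift b.dir) = blockOf b.src ∧ ∀ ν, ν < b.dir → rel (emb (blockOf b.src)) b.src ν = 0) then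
        logVec (su2Quat ((lift j (GaugeField.gaugeAct (g (j + 1)) (Averaging.iter av (j + 1) U)) b *
            (lift j (GaugeField.gaugeAct (g₀ (j + 1)) (Averaging.iter av (j + 1) U₁)) b)⁻¹)⁻¹ *
          (GaugeField.gaugeAct (g j) (Averaging.iter av j U) b * (GaugeField.gaugeAct (g₀ j) (Averaging.iter av j U₁) b)⁻¹))) else 0) b) (fun b hb m hm => ?_) hnest
  have h := norm_logVec_rawChord_le_lift_add_disc av hj wt lift g g₀ U U₁ U₀ hwt hlift hT3 hT3s hT3' hT3s' hU₀ b hL2 hσ4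
    (fun e he => hσ e (hnest b hb e he)) (fun e he => hσ' e (hnest b hb e he)) hm
  have hsrc : ‖logVec (su2Quat ((lift j (GaugeField.gaugeAct (g (j + 1)) (Averaging.iter av (j + 1) U)) b *
            (lift j (GaugeField.gaugeAct (g₀ (j + 1)) (Averaging.iter av (j + 1) U₁)) b)⁻¹)⁻¹ *
          (GaugeField.gaugeAct (g j) (Averaging.iter av j U) b * (GaugeField.gaugeAct (g₀ j) (Averaging.iter av j U₁) b)⁻¹)))‖ ≤
      ‖(fun b : PBond P j => if pS b ∧ ¬ (blockOf (b.src.shift b.dir) = blockOf b.src ∧ ∀ ν, ν < b.dir → rel (emb (blockOf b.src)) b.src ν = 0) then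
        logVec (su2Quat ((lift j (GaugeField.gaugeAct (g (j + 1)) (Averaging.iter av (j + 1) U)) b *
            (lift j (GaugeField.gaugeAct (g₀ (j + 1)) (Averaging.iter av (j + 1) U₁)) b)⁻¹)⁻¹ *
          (GaugeField.gaugeAct (g j) (Averaging.iter av j U) b * (GaugeField.gaugeAct (g₀ j) (Averaging.iter av j U₁) b)⁻¹))) else 0) b‖ := by
    by_cases hcomb : blockOf (b.src.shift b.dir) = blockOf b.src ∧ ∀ ν, ν < b.dir → rel (emb (blockOf b.src)) b.src ν = 0
    · have h0 : logVec (su2Quat ((lift j (GaugeField.gaugeAct (g (j + 1)) (Averaging.iter av (j + 1) U)) b *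
            (lift j (GaugeField.gaugeAct (g₀ (j + 1)) (Averaging.iter av (j + 1) U₁)) b)⁻¹)⁻¹ *
          (GaugeField.gaugeAct (g j) (Averaging.iter av j U) b * (GaugeField.gaugeAct (g₀ j) (Averaging.iter av j U₁) b)⁻¹))) = 0 := by
        obtain ⟨x, μ⟩ := b
        rw [disc_eq_one_of_treeComb av hj lift g g₀ U U₁ hT4 hT4' x μ hcomb.1 hcomb.2]
        exact FluctuationComparisonRegPrIntLS2BetaWhitneyHatLift.logVec_su2Quat_one
      rw [h0, norm_zero]
      exact norm_nonneg _
    · apply le_of_eq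
      dsimp only
      rw [if_pos (And.intro hb hcomb)]
  calc ‖logVec (su2Quat (Averaging.iter av j U b * (Averaging.iter av j U₀ b)⁻¹))‖
      ≤ 11 / 10 * ((P.L : ℝ)⁻¹ * m) + _ := h
    _ ≤ 11 / 10 * (P.L : ℝ)⁻¹ * m + _ := by rw [← mul_assoc]; exact add_le_add le_rfl hsrc

end OneParams

/-! ## §2 THE ONE-PROFILE LIFT ROW AT THE TOWER: `E′(t+1) ≤ (1+κ)(11∕10·L⁻¹)²·E′(t) + (1+κ⁻¹)·D′(t+1)`, `D′` the truncated discrepancy energy off the comb -/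

section Tower

variable {F : T3Family}

open T3UnitLawDensityEML (ℰp)

/-- ★★★ **THE ONE-PROFILE LIFT ROW OF (LIFT-LAD′) FOR THE DESCENDED PAIR ON THE THICKENED READ SETS, LETTER-FREE SOURCE** (ARCHITECT px17 g22 19:37:59Z (1): every bond of
`READ′_{t+1}(B)` has main part the relative lift and discrepancy `ε = R⁻¹η`).  Under ✓p831621 `combRow'`'s hypotheses VERBATIM (the `AxStage` witness clauses, `2 ≤ L`, the arc
profile `σ ≤ 1∕4`) and `κ > 0`: for every `t + 1 < K − J` and the internal height `s = K − (J+t+2)` of `F.P K` (any `s` with `hs`),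
`E′(t+1) ≤ ((1+κ)·(11∕10·L⁻¹)²)·E′(t) + (1+κ⁻¹)·D′(t+1)`, where `E′` is FILE 3′∕3″'s READ′ summand VERBATIM (✓p831146 ∕ ✓p831454) and
`D′(t+1) := Σ_B ‖𝟙_{READ′_{t+1}(B) ∧ ¬comb}·logVec (R⁻¹η)‖²` is the truncated DISCREPANCY energy off the tree comb, read in `F.P K` at height `s` through the level
identification `σ₂` — so ✓p831454's abstract `c(t+1)` is instantiated by `(1+κ⁻¹)·D′(t+1)` with NO source letter; bounding `Σ_t L^t·D′` is the suppliers' (SCT′-c) budget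
(px5 g23's per-`B` row ∕ ⧗Q11f for intra-block bonds, RULING (i)'s face discrepancy, px16∕px13's sums).  Proof = ✓`combRow'`'s plumbing (✓`descendTo_apply_eq_iter_of_eq`,
✓`treeComb_siteShift`, ✓`read'_nest_of_feeds`, ✓`blockIter_succ_eq_siteShift`) around §1's pointwise source. [cite: Balaban1985RegularSpaces, (1.19) p.79, (1.29) p.81; Balaban1985Averaging, Prop. 4 (128)-(135) p.37-38; Balaban1987RG1, (0.4), (0.11) p.253] -/
theorem liftRow'  {J K : ℕ} (hJK : J ≤ K) (U₀ : GaugeField (F.P K) 0 (Matrix.specialUnitaryGroup (Fin 2) ℂ)) (ζ : PBond (F.P K) 0 → EuclideanSpace ℝ (Fin 3))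
    (wt : (j : ℕ) → PBond (F.P K) j → PBond (F.P K) (j + 1) → ℝ)
    (lift : (j : ℕ) → GaugeField (F.P K) (j + 1) SU2 → GaugeField (F.P K) j SU2)
    (U₁ : GaugeField (F.P K) 0 SU2) (g g₀ : (j : ℕ) → Site (F.P K) j → SU2)
    (hwt : ∀ j b e, wt j b e = if e.dir = b.dir ∧ (b.src b.dir - emb e.src b.dir).val < (F.P K).L then
        ∏ ν ∈ Finset.univ.erase b.dir, max 0 (1 - ((rel (emb e.src) b.src ν).natAbs : ℝ) / (F.P K).L) else 0)
    (hlift : ∀ j X b, lift j X b = expPoint (∑ e, wt j b e • ((((F.P K).L : ℕ) : ℝ)⁻¹ • logVec (su2Quat (X e)))))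
    (hT3 : ∀ X : GaugeField (F.P K) 0 SU2, ∀ j, j ≤ K - J →
      Averaging.iter (fun k => blockAvg (P := F.P K) (j := k) ℰp) j (GaugeField.gaugeAct (g 0) X) =
        GaugeField.gaugeAct (g j) (Averaging.iter (fun k => blockAvg (P := F.P K) (j := k) ℰp) j X))
    (hT4 : ∀ j, j < K - J → ∀ x,
      axialT (GaugeField.gaugeAct (g j) (Averaging.iter (fun k => blockAvg (P := F.P K) (j := k) ℰp) j (fun ℓ => expPoint (ζ ℓ) * U₀ ℓ))) (emb (blockOf x)) x =
        axialT (lift j (GaugeField.gaugeAct (g (j + 1)) (Averaging.iter (fun k => blockAvg (P := F.P K) (j := k) ℰp) (j + 1) (fun ℓ => expPoint (ζ ℓ) * U₀ ℓ))))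
          (emb (blockOf x)) x)
    (hT3' : ∀ X : GaugeField (F.P K) 0 SU2, ∀ j, j ≤ K - J →
      Averaging.iter (fun k => blockAvg (P := F.P K) (j := k) ℰp) j (GaugeField.gaugeAct (g₀ 0) X) =
        GaugeField.gaugeAct (g₀ j) (Averaging.iter (fun k => blockAvg (P := F.P K) (j := k) ℰp) j X))
    (hT4' : ∀ j, j < K - J → ∀ x,
      axialT (GaugeField.gaugeAct (g₀ j) (Averaging.iter (fun k => blockAvg (P := F.P K) (j := k) ℰp) j U₁)) (emb (blockOf x)) x =
        axialT (lift j (GaugeField.gaugeAct (g₀ (j + 1)) (Averaging.iter (fun k => blockAvg (P := F.P K) (j := k) ℰp) (j + 1) U₁)))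
          (emb (blockOf x)) x)
    (hU₀ : U₀ = GaugeField.gaugeAct (fun x => (g 0 x)⁻¹ * g₀ 0 x) U₁)
    (hL2 : 2 ≤ F.L) {σ : ℝ} (hσ4 : σ ≤ 1 / 4)
    (hArc : ∀ i, 1 ≤ i → i < K - J → ∀ e : PBond (F.P K) i,
      ‖logVec (su2Quat (GaugeField.gaugeAct (g i) (Averaging.iter (fun k => blockAvg (P := F.P K) (j := k) ℰp) i (fun ℓ => expPoint (ζ ℓ) * U₀ ℓ)) e))‖ ≤ σ ∧
      ‖logVec (su2Quat (GaugeField.gaugeAct (g₀ i) (Averaging.iter (fun k => blockAvg (P := F.P K) (j := k) ℰp) i U₁) e))‖ ≤ σ) {κ : ℝ} (hκ : 0 < κ) :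
    ∀ (t s : ℕ) (hs : s = K - (J + (t + 1 + 1))) (ht1 : t + 1 < K - J),
      (fun (t : ℕ) (ht : t < K - J) => ∑ B : PBond (F.P J) 0,
            ‖(fun ℓ' : PBond (F.P (J + (t + 1))) 0 =>
              if ∃ z : Site (F.P (J + (t + 1))) 0,
                (B14.Eq22Determines.blockIter (t + 1) z = (bondShift (F.sitesPerDir_eq (m := F.m) (K := J) (j := 0) (m' := F.m) (K' := J + (t + 1)) (j' := t + 1) (by omega)) B).src ∨ B14.Eq22Determines.blockIter (t + 1) z = (bondShift (F.sitesPerDir_eq (m := F.m) (K := J) (j := 0) (m' := F.m) (K' := J + (t + 1)) (j' := t + 1) (by omega)) B).tgt) ∧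
                ∀ ν, (B10Eq27TorusAxialLog.rel z ℓ'.src ν).natAbs ≤ 2
              then logVec (su2Quat (descendTo F ℰp (J + (t + 1)) K (by omega) (fun ℓ => expPoint (ζ ℓ) * U₀ ℓ : GaugeField (F.P K) 0 (Matrix.specialUnitaryGroup (Fin 2) ℂ)) ℓ' * (descendTo F ℰp (J + (t + 1)) K (by omega) U₀ ℓ')⁻¹)) else 0)‖ ^ 2) (t + 1) ht1 ≤
        ((1 + κ) * (11 / 10 * (F.L : ℝ)⁻¹) ^ 2) * (fun (t : ℕ) (ht : t < K - J) => ∑ B : PBond (F.P J) 0,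
            ‖(fun ℓ' : PBond (F.P (J + (t + 1))) 0 =>
              if ∃ z : Site (F.P (J + (t + 1))) 0,
                (B14.Eq22Determines.blockIter (t + 1) z = (bondShift (F.sitesPerDir_eq (m := F.m) (K := J) (j := 0) (m' := F.m) (K' := J + (t + 1)) (j' := t + 1) (by omega)) B).src ∨ B14.Eq22Determines.blockIter (t + 1) z = (bondShift (F.sitesPerDir_eq (m := F.m) (K := J) (j := 0) (m' := F.m) (K' := J + (t + 1)) (j' := t + 1) (by omega)) B).tgt) ∧
                ∀ ν, (B10Eq27TorusAxialLog.rel z ℓ'.src ν).natAbs ≤ 2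
              then logVec (su2Quat (descendTo F ℰp (J + (t + 1)) K (by omega) (fun ℓ => expPoint (ζ ℓ) * U₀ ℓ : GaugeField (F.P K) 0 (Matrix.specialUnitaryGroup (Fin 2) ℂ)) ℓ' * (descendTo F ℰp (J + (t + 1)) K (by omega) U₀ ℓ')⁻¹)) else 0)‖ ^ 2) t (Nat.lt_of_succ_lt ht1) +
        (1 + κ⁻¹) * ∑ B : PBond (F.P J) 0,
            ‖(fun ℓ' : PBond (F.P (J + (t + 1 + 1))) 0 =>
              if (∃ z : Site (F.P (J + (t + 1 + 1))) 0,
                (B14.Eq22Determines.blockIter (t + 1 + 1) z = (bondShift (F.sitesPerDir_eq (m := F.m) (K := J) (j := 0) (m' := F.m) (K' := J + (t + 1 + 1)) (j' := t + 1 + 1) (by omega)) B).src ∨ B14.Eq22Determines.blockIter (t + 1 + 1) z = (bondShift (F.sitesPerDir_eq (m := F.m) (K := J) (j := 0) (m' := F.m) (K' := J + (t + 1 + 1)) (j' := t + 1 + 1) (by omega)) B).tgt) ∧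
                ∀ ν, (B10Eq27TorusAxialLog.rel z ℓ'.src ν).natAbs ≤ 2) ∧
                ¬ (blockOf (ℓ'.src.shift ℓ'.dir) = blockOf ℓ'.src ∧ ∀ ν, ν < ℓ'.dir → B10Eq27TorusAxialLog.rel (emb (blockOf ℓ'.src)) ℓ'.src ν = 0)
              then logVec (su2Quat ((lift s (GaugeField.gaugeAct (g (s + 1)) (Averaging.iter (fun k => blockAvg (P := F.P K) (j := k) ℰp) (s + 1) (fun ℓ => expPoint (ζ ℓ) * U₀ ℓ))) (bondShift (F.sitesPerDir_eq (m := F.m) (K := J + (t + 1 + 1)) (j := 0) (m' := F.m) (K' := K) (j' := s) (by omega)) ℓ') *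
                    (lift s (GaugeField.gaugeAct (g₀ (s + 1)) (Averaging.iter (fun k => blockAvg (P := F.P K) (j := k) ℰp) (s + 1) U₁)) (bondShift (F.sitesPerDir_eq (m := F.m) (K := J + (t + 1 + 1)) (j := 0) (m' := F.m) (K' := K) (j' := s) (by omega)) ℓ'))⁻¹)⁻¹ *
                  (GaugeField.gaugeAct (g s) (Averaging.iter (fun k => blockAvg (P := F.P K) (j := k) ℰp) s (fun ℓ => expPoint (ζ ℓ) * U₀ ℓ)) (bondShift (F.sitesPerDir_eq (m := F.m) (K := J + (t + 1 + 1)) (j := 0) (m' := F.m) (K' := K) (j' := s) (by omega)) ℓ') *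
                    (GaugeField.gaugeAct (g₀ s) (Averaging.iter (fun k => blockAvg (P := F.P K) (j := k) ℰp) s U₁) (bondShift (F.sitesPerDir_eq (m := F.m) (K := J + (t + 1 + 1)) (j := 0) (m' := F.m) (K' := K) (j' := s) (by omega)) ℓ'))⁻¹))) else 0)‖ ^ 2 := by
  have _h := hJK
  intro t s hsd ht1
  beta_reduce
  -- the internal heights of `F.P K`: fine `s = K − J − t − 2`, coarse `s + 1 = K − J − t − 1`
  have hs1d : s + 1 = K - (J + (t + 1)) := by omega
  have hsK : s + 1 ≤ (F.P K).m + (F.P K).K := by show s + 1 ≤ F.m + K; omega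
  have hsle : s ≤ K - J := by omega
  have hs1le : s + 1 ≤ K - J := by omega
  have hslt : s < K - J := by omega
  have P₂ : (F.P (J + (t + 1 + 1))).sitesPerDir 0 = (F.P K).sitesPerDir s := F.sitesPerDir_eq (by omega)
  have P₁ : (F.P (J + (t + 1))).sitesPerDir 0 = (F.P K).sitesPerDir (s + 1) := F.sitesPerDir_eq (by omega)
  have Q₁ : (F.P (J + (t + 1 + 1))).sitesPerDir 1 = (F.P K).sitesPerDir (s + 1) := F.sitesPerDir_eq (by omega)
  have hL2' : 2 ≤ (F.P K).L := hL2
  -- constants out of the sums, then bond set by bond set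
  rw [Finset.mul_sum, Finset.mul_sum, ← Finset.sum_add_distrib]
  refine Finset.sum_le_sum fun B _ => ?_
  -- Young's split per `B`, then the row with the pointwise source
  refine sq_le_of_le_mul_add (norm_nonneg _) (by positivity) (norm_nonneg _) hκ ?_
  have hc0 : (0 : ℝ) ≤ 11 / 10 * (F.L : ℝ)⁻¹ := by positivity
  refine pi_norm_trunc_le_of_row_add _ _ (fun ℓ'' ℓ' => wt s (bondShift P₂ ℓ'') (bondShift P₁ ℓ') ≠ 0) _ _ hc0
    (fun ℓ'' => ‖(fun ℓ' : PBond (F.P (J + (t + 1 + 1))) 0 =>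
              if (∃ z : Site (F.P (J + (t + 1 + 1))) 0,
                (B14.Eq22Determines.blockIter (t + 1 + 1) z = (bondShift (F.sitesPerDir_eq (m := F.m) (K := J) (j := 0) (m' := F.m) (K' := J + (t + 1 + 1)) (j' := t + 1 + 1) (by omega)) B).src ∨ B14.Eq22Determines.blockIter (t + 1 + 1) z = (bondShift (F.sitesPerDir_eq (m := F.m) (K := J) (j := 0) (m' := F.m) (K' := J + (t + 1 + 1)) (j' := t + 1 + 1) (by omega)) B).tgt) ∧
                ∀ ν, (B10Eq27TorusAxialLog.rel z ℓ'.src ν).natAbs ≤ 2) ∧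
                ¬ (blockOf (ℓ'.src.shift ℓ'.dir) = blockOf ℓ'.src ∧ ∀ ν, ν < ℓ'.dir → B10Eq27TorusAxialLog.rel (emb (blockOf ℓ'.src)) ℓ'.src ν = 0)
              then logVec (su2Quat ((lift s (GaugeField.gaugeAct (g (s + 1)) (Averaging.iter (fun k => blockAvg (P := F.P K) (j := k) ℰp) (s + 1) (fun ℓ => expPoint (ζ ℓ) * U₀ ℓ))) (bondShift (F.sitesPerDir_eq (m := F.m) (K := J + (t + 1 + 1)) (j := 0) (m' := F.m) (K' := K) (j' := s) (by omega)) ℓ') *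
                    (lift s (GaugeField.gaugeAct (g₀ (s + 1)) (Averaging.iter (fun k => blockAvg (P := F.P K) (j := k) ℰp) (s + 1) U₁)) (bondShift (F.sitesPerDir_eq (m := F.m) (K := J + (t + 1 + 1)) (j := 0) (m' := F.m) (K' := K) (j' := s) (by omega)) ℓ'))⁻¹)⁻¹ *
                  (GaugeField.gaugeAct (g s) (Averaging.iter (fun k => blockAvg (P := F.P K) (j := k) ℰp) s (fun ℓ => expPoint (ζ ℓ) * U₀ ℓ)) (bondShift (F.sitesPerDir_eq (m := F.m) (K := J + (t + 1 + 1)) (j := 0) (m' := F.m) (K' := K) (j' := s) (by omega)) ℓ') *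
                    (GaugeField.gaugeAct (g₀ s) (Averaging.iter (fun k => blockAvg (P := F.P K) (j := k) ℰp) s U₁) (bondShift (F.sitesPerDir_eq (m := F.m) (K := J + (t + 1 + 1)) (j := 0) (m' := F.m) (K' := K) (j' := s) (by omega)) ℓ'))⁻¹))) else 0) ℓ''‖)
    (norm_nonneg _) (fun ℓ'' _ => norm_le_pi_norm
      (fun ℓ' : PBond (F.P (J + (t + 1 + 1))) 0 =>
              if (∃ z : Site (F.P (J + (t + 1 + 1))) 0,
                (B14.Eq22Determines.blockIter (t + 1 + 1) z = (bondShift (F.sitesPerDir_eq (m := F.m) (K := J) (j := 0) (m' := F.m) (K' := J + (t + 1 + 1)) (j' := t + 1 + 1) (by omega)) B).src ∨ B14.Eq22Determines.blockIter (t + 1 + 1) z = (bondShift (F.sitesPerDir_eq (m := F.m) (K := J) (j := 0) (m' := F.m) (K' := J + (t + 1 + 1)) (j' := t + 1 + 1) (by omega)) B).tgt) ∧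
                ∀ ν, (B10Eq27TorusAxialLog.rel z ℓ'.src ν).natAbs ≤ 2) ∧
                ¬ (blockOf (ℓ'.src.shift ℓ'.dir) = blockOf ℓ'.src ∧ ∀ ν, ν < ℓ'.dir → B10Eq27TorusAxialLog.rel (emb (blockOf ℓ'.src)) ℓ'.src ν = 0)
              then logVec (su2Quat ((lift s (GaugeField.gaugeAct (g (s + 1)) (Averaging.iter (fun k => blockAvg (P := F.P K) (j := k) ℰp) (s + 1) (fun ℓ => expPoint (ζ ℓ) * U₀ ℓ))) (bondShift (F.sitesPerDir_eq (m := F.m) (K := J + (t + 1 + 1)) (j := 0) (m' := F.m) (K' := K) (j' := s) (by omega)) ℓ') *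
                    (lift s (GaugeField.gaugeAct (g₀ (s + 1)) (Averaging.iter (fun k => blockAvg (P := F.P K) (j := k) ℰp) (s + 1) U₁)) (bondShift (F.sitesPerDir_eq (m := F.m) (K := J + (t + 1 + 1)) (j := 0) (m' := F.m) (K' := K) (j' := s) (by omega)) ℓ'))⁻¹)⁻¹ *
                  (GaugeField.gaugeAct (g s) (Averaging.iter (fun k => blockAvg (P := F.P K) (j := k) ℰp) s (fun ℓ => expPoint (ζ ℓ) * U₀ ℓ)) (bondShift (F.sitesPerDir_eq (m := F.m) (K := J + (t + 1 + 1)) (j := 0) (m' := F.m) (K' := K) (j' := s) (by omega)) ℓ') *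
                    (GaugeField.gaugeAct (g₀ s) (Averaging.iter (fun k => blockAvg (P := F.P K) (j := k) ℰp) s U₁) (bondShift (F.sitesPerDir_eq (m := F.m) (K := J + (t + 1 + 1)) (j := 0) (m' := F.m) (K' := K) (j' := s) (by omega)) ℓ'))⁻¹))) else 0) ℓ'') (fun ℓ'' hS m hm => ?_) (fun ℓ'' hS ℓ' hfe => ?_)
  · -- THE ROW PER BOND (✓`norm_logVec_rawChord_le_lift_add_disc` at heights `s ∕ s+1` of `F.P K`, through the dictionary)
    rw [descendTo_apply_eq_iter_of_eq F (n := J + (t + 1 + 1)) (by omega) hsd (fun ℓ => expPoint (ζ ℓ) * U₀ ℓ) ℓ'',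
      descendTo_apply_eq_iter_of_eq F (n := J + (t + 1 + 1)) (by omega) hsd U₀ ℓ'']
    have hmK : ∀ e : PBond (F.P K) (s + 1), wt s ⟨siteShift P₂ ℓ''.src, ℓ''.dir⟩ e ≠ 0 →
        ‖logVec (su2Quat (Averaging.iter (fun k => blockAvg (P := F.P K) (j := k) ℰp) (s + 1) (fun ℓ => expPoint (ζ ℓ) * U₀ ℓ) e *
          (Averaging.iter (fun k => blockAvg (P := F.P K) (j := k) ℰp) (s + 1) U₀ e)⁻¹))‖ ≤ m := fun e he => by
      have h1 := hm ((bondShift P₁).symm e) (by rwa [Equiv.apply_symm_apply])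
      rwa [descendTo_apply_eq_iter_of_eq F (n := J + (t + 1)) (by omega) hs1d (fun ℓ => expPoint (ζ ℓ) * U₀ ℓ),
        descendTo_apply_eq_iter_of_eq F (n := J + (t + 1)) (by omega) hs1d U₀, Equiv.apply_symm_apply] at h1
    have key := norm_logVec_rawChord_le_lift_add_disc (fun k => blockAvg (P := F.P K) (j := k) ℰp) hsK wt lift g g₀
      (fun ℓ => expPoint (ζ ℓ) * U₀ ℓ) U₁ U₀ (hwt s) (fun X b => hlift s X b) (fun X => hT3 X s hsle) (fun X => hT3 X (s + 1) hs1le)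
      (fun X => hT3' X s hsle) (fun X => hT3' X (s + 1) hs1le) hU₀ ⟨siteShift P₂ ℓ''.src, ℓ''.dir⟩ hL2' hσ4
      (fun e _ => (hArc (s + 1) (by omega) (by omega) e).1) (fun e _ => (hArc (s + 1) (by omega) (by omega) e).2) hmK
    have eL : (((F.P K).L : ℕ) : ℝ) = (F.L : ℝ) := rfl
    rw [eL] at key
    -- the discrepancy arc is the pointwise norm of the truncated field off the comb, `0` on the comb
    have hsrc : ‖logVec (su2Quat ((lift s (GaugeField.gaugeAct (g (s + 1)) (Averaging.iter (fun k => blockAvg (P := F.P K) (j := k) ℰp) (s + 1) (fun ℓ => expPoint (ζ ℓ) * U₀ ℓ))) ⟨siteShift P₂ ℓ''.src, ℓ''.dir⟩ *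
            (lift s (GaugeField.gaugeAct (g₀ (s + 1)) (Averaging.iter (fun k => blockAvg (P := F.P K) (j := k) ℰp) (s + 1) U₁)) ⟨siteShift P₂ ℓ''.src, ℓ''.dir⟩)⁻¹)⁻¹ *
          (GaugeField.gaugeAct (g s) (Averaging.iter (fun k => blockAvg (P := F.P K) (j := k) ℰp) s (fun ℓ => expPoint (ζ ℓ) * U₀ ℓ)) ⟨siteShift P₂ ℓ''.src, ℓ''.dir⟩ *
            (GaugeField.gaugeAct (g₀ s) (Averaging.iter (fun k => blockAvg (P := F.P K) (j := k) ℰp) s U₁) ⟨siteShift P₂ ℓ''.src, ℓ''.dir⟩)⁻¹)))‖ ≤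
        ‖(fun ℓ' : PBond (F.P (J + (t + 1 + 1))) 0 =>
              if (∃ z : Site (F.P (J + (t + 1 + 1))) 0,
                (B14.Eq22Determines.blockIter (t + 1 + 1) z = (bondShift (F.sitesPerDir_eq (m := F.m) (K := J) (j := 0) (m' := F.m) (K' := J + (t + 1 + 1)) (j' := t + 1 + 1) (by omega)) B).src ∨ B14.Eq22Determines.blockIter (t + 1 + 1) z = (bondShift (F.sitesPerDir_eq (m := F.m) (K := J) (j := 0) (m' := F.m) (K' := J + (t + 1 + 1)) (j' := t + 1 + 1) (by omega)) B).tgt) ∧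
                ∀ ν, (B10Eq27TorusAxialLog.rel z ℓ'.src ν).natAbs ≤ 2) ∧
                ¬ (blockOf (ℓ'.src.shift ℓ'.dir) = blockOf ℓ'.src ∧ ∀ ν, ν < ℓ'.dir → B10Eq27TorusAxialLog.rel (emb (blockOf ℓ'.src)) ℓ'.src ν = 0)
              then logVec (su2Quat ((lift s (GaugeField.gaugeAct (g (s + 1)) (Averaging.iter (fun k => blockAvg (P := F.P K) (j := k) ℰp) (s + 1) (fun ℓ => expPoint (ζ ℓ) * U₀ ℓ))) (bondShift (F.sitesPerDir_eq (m := F.m) (K := J + (t + 1 + 1)) (j := 0) (m' := F.m) (K' := K) (j' := s) (by omega)) ℓ') *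
                    (lift s (GaugeField.gaugeAct (g₀ (s + 1)) (Averaging.iter (fun k => blockAvg (P := F.P K) (j := k) ℰp) (s + 1) U₁)) (bondShift (F.sitesPerDir_eq (m := F.m) (K := J + (t + 1 + 1)) (j := 0) (m' := F.m) (K' := K) (j' := s) (by omega)) ℓ'))⁻¹)⁻¹ *
                  (GaugeField.gaugeAct (g s) (Averaging.iter (fun k => blockAvg (P := F.P K) (j := k) ℰp) s (fun ℓ => expPoint (ζ ℓ) * U₀ ℓ)) (bondShift (F.sitesPerDir_eq (m := F.m) (K := J + (t + 1 + 1)) (j := 0) (m' := F.m) (K' := K) (j' := s) (by omega)) ℓ') *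
                    (GaugeField.gaugeAct (g₀ s) (Averaging.iter (fun k => blockAvg (P := F.P K) (j := k) ℰp) s U₁) (bondShift (F.sitesPerDir_eq (m := F.m) (K := J + (t + 1 + 1)) (j := 0) (m' := F.m) (K' := K) (j' := s) (by omega)) ℓ'))⁻¹))) else 0) ℓ''‖ := by
      by_cases hcomb : blockOf (ℓ''.src.shift ℓ''.dir) = blockOf ℓ''.src ∧ ∀ ν, ν < ℓ''.dir → B10Eq27TorusAxialLog.rel (emb (blockOf ℓ''.src)) ℓ''.src ν = 0
      · obtain ⟨hblk', hlo'⟩ := treeComb_siteShift P₂ Q₁ ℓ''.src ℓ''.dir hcomb.1 hcomb.2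
        rw [disc_eq_one_of_treeComb (fun k => blockAvg (P := F.P K) (j := k) ℰp) hsK lift g g₀ (fun ℓ => expPoint (ζ ℓ) * U₀ ℓ) U₁
          (hT4 s hslt) (hT4' s hslt) (siteShift P₂ ℓ''.src) ℓ''.dir hblk' hlo',
          FluctuationComparisonRegPrIntLS2BetaWhitneyHatLift.logVec_su2Quat_one, norm_zero]
        exact norm_nonneg _
      · apply le_of_eq
        dsimp only
        split_ifs with hif
        · rfl
        · exact (hif ⟨hS, hcomb⟩).elim
    calc ‖logVec (su2Quat (Averaging.iter (fun k => blockAvg (P := F.P K) (j := k) ℰp) s (fun ℓ => expPoint (ζ ℓ) * U₀ ℓ) (bondShift P₂ ℓ'') *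
            (Averaging.iter (fun k => blockAvg (P := F.P K) (j := k) ℰp) s U₀ (bondShift P₂ ℓ''))⁻¹))‖
        ≤ 11 / 10 * ((F.L : ℝ)⁻¹ * m) + _ := key
      _ ≤ 11 / 10 * (F.L : ℝ)⁻¹ * m + _ := by rw [← mul_assoc]; exact add_le_add le_rfl hsrc
  · -- THE FEEDERS LIE IN READ′_t(B) (✓`read'_nest_of_feeds` + ✓`blockIter_succ_eq_siteShift`, exactly as in ✓`combRow'`)
    obtain ⟨z, hzB, hz2⟩ := hS
    obtain ⟨hx, hy2⟩ := read'_nest_of_feeds (n := J + (t + 1)) (K := K) (s := s) (by omega) (by omega) hsK (wt s) (hwt s) ℓ'' ℓ' hfe hz2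
    refine ⟨_, ?_, hy2⟩
    have H := blockIter_succ_eq_siteShift (K₁ := J + (t + 1)) _ z hx (t + 1)
    rcases hzB with h | h
    · left
      have e1 := H.symm.trans h
      rw [bondShift_src] at e1
      rw [bondShift_src]
      exact (siteShift _).injective (e1.trans (by rw [siteShift_siteShift]))
    · right
      have e1 := H.symm.trans h
      rw [bondShift_tgt] at e1
      rw [bondShift_tgt]
      exact (siteShift _).injective (e1.trans (by rw [siteShift_siteShift]))

end Tower

end Summit.QuantumFields.YangMills.Theorems.FluctuationComparisonRegPrIntLS2BetaLiftLadderOneProfileTower
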